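import Literature.MathematicalPhysics.KineticTheory.TransportRegularityOfMixing
import Literature.MathematicalPhysics.KineticTheory.FluctuationClusteringSpan
import Summits.AtomisticToContinuum.FouriersLaw.Theorems.EmbeddedDrudeMourreGreenKuboContinuationAtomEqDrudeWeight

/-!
# Stub `stub_drudeFromTruncationRegular` (DFT′) of line `drude-controls-conductance` (R3b) — crux
`JunctionLocality.NonBallistic` (stmt-AtomisticToContinuum-9127), part 1: zero-wavenumber data with an
arbitrary set of generators, and the Hilbert-space bookkeeping of Drude weights

Helper file (`--supports stmt-AtomisticToContinuum-9127`); nothing here closes the item.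

* §1 `integrable_cov_generators_of_subset`, `exists_zeroWavenumberData_of_subset`: the two assembly
  theorems `InfiniteChainDynamics.integrable_cov_generators` / `exists_zeroWavenumberData_of_clustering`
  of the tree (generators `{j₀, h₀}`) re-run for an ARBITRARY set `S ∋ j₀, h₀` of local square-integrable
  generators with fixed-time `L²` locality (so that a clipped current `clip_M ∘ j₀` can be a local
  observable of Doyon's `ℋ₀`).
* §2 von Neumann / Suzuki in `ℋ`: for a strongly continuous Koopman group,
  `τ⁻¹∫₀^τ ⟪ψ, U_t ψ⟫ → ‖ℙψ‖²` (`tendsto_cesaro_inner_koopman`, from the tree's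
  `Mazur.tendsto_inv_mul_integral_inner` + `isContractionSemigroup_koopmanCLM`); a class whose Cesàro means
  are eventually `≤ η` for every `η > 0` has `ℙφ = 0`; and `‖ℙψ‖ ≤ ‖ψ - φ‖` for such `φ`.
* §3 `exists_tsum_abs_cov_self_le_of_mixing`: under exponential `ρ`-mixing, `Σ_w |Cov(f, f ∘ τ_w)| ≤ K ∫ f²`
  for every `f` reading the sites of `[-1, 1]`, with ONE constant `K = K(C, m)`;
* the registered sub-goal `stub_zeroWavenumberDataOfGenerators` (= `exists_zeroWavenumberData_of_subset`).
-/

noncomputable section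

namespace Summit.AtomisticToContinuum.FouriersLaw.Theorems.NonBallistic.DrudeFromTruncation

open MeasureTheory ProbabilityTheory Filter Topology Set Function
open scoped NNReal ENNReal InnerProductSpace
open Literature.MathematicalPhysics.KineticTheory
open Literature.MathematicalPhysics.KineticTheory.HeatConduction

/-! ### §1 Zero-wavenumber data generated by an arbitrary set of local generators -/

section Generators

variable {P : OscillatorChain} (D : InfiniteChainDynamics P)

/-- **Summable clustering of the generator pairs from (M) + (L), arbitrary generator set.** Let `D` have
carrier `𝒳₀` and be the identity off `𝒳₀` (`U, V ≥ 0`), `μ` a probability measure preserved by `D` and by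
the lattice translations, (M) exponential `ρ`-mixing of `μ` between half-lines, and `S` a set of
measurable square-integrable generators reading the sites of `[-1, 1]` with (L) `L²(μ)` locality of
`a ∘ φ_t`, uniformly on `|t| ≤ τ`, with summable rate, for every `a ∈ S`. Then every pair
`(a ∘ τ_y) ∘ φ_s`, `(b ∘ τ_z) ∘ φ_u` (`a, b ∈ S`) has summable truncated correlations. [folklore]
-- adapted from `InfiniteChainDynamics.integrable_cov_generators` (generators `{j₀, h₀}`) -/
theorem integrable_cov_generators_of_subset (hU0 : ∀ r, 0 ≤ P.U r) (hV0 : ∀ r, 0 ≤ P.V r)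
    (hcar : D.carrier = P.bmGood)
    (hid : ∀ (t : ℝ) (σ : ChainConfig), σ ∉ P.bmGood → D.flow t σ = σ)
    {μ : Measure ChainConfig} [IsProbabilityMeasure μ]
    (hτ : ∀ x : ℤ, MeasurePreserving (chainShift x) μ μ) (hD : D.PreservesMeasure μ)
    {C m : ℝ} (hC : 0 ≤ C) (hm : 0 < m)
    (hmix : ∀ (a : ℤ) (n : ℕ) (f g : ChainConfig → ℝ),
      DependsOn f {i : ℤ | i ≤ a} → DependsOn g {i : ℤ | a + n ≤ i} → Measurable f → Measurable g →
      MemLp f 2 μ → MemLp g 2 μ →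
      |∫ σ, f σ * g σ ∂μ - (∫ σ, f σ ∂μ) * ∫ σ, g σ ∂μ| ≤
        C * Real.exp (-(m * n)) * (∫ σ, f σ ^ 2 ∂μ) ^ (1 / 2 : ℝ) * (∫ σ, g σ ^ 2 ∂μ) ^ (1 / 2 : ℝ))
    (S : Set (ChainConfig → ℝ))
    (hgenM : ∀ a ∈ S, Measurable a ∧ DependsOn a (Icc (-1 : ℤ) 1) ∧ MemLp a 2 μ)
    (hloc : ∀ a ∈ S, ∀ τ : ℝ, 0 ≤ τ → ∃ ε : ℕ → ℝ, (∀ n, 0 ≤ ε n) ∧ Summable ε ∧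
      ∀ t : ℝ, |t| ≤ τ → ∀ n : ℕ,
        ∃ g : ChainConfig → ℝ, DependsOn g (Icc (-(n : ℤ) - 1) (n + 1)) ∧ Measurable g ∧
          MemLp g 2 μ ∧ Real.sqrt (∫ σ, (a (D.flow t σ) - g σ) ^ 2 ∂μ) ≤ ε n) :
    ∀ a ∈ {b : ChainConfig → ℝ | ∃ a ∈ S, ∃ (x : ℤ) (s : ℝ), b = (a ∘ chainShift x) ∘ D.flow s},
      ∀ b ∈ {b : ChainConfig → ℝ | ∃ a ∈ S, ∃ (x : ℤ) (s : ℝ), b = (a ∘ chainShift x) ∘ D.flow s},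
      Integrable (fun x : ℤ => cov[a, b ∘ chainShift x; μ]) (Measure.count : Measure ℤ) := by
  rintro a ⟨a₁, ha₁, y, s, rfl⟩ b ⟨b₁, hb₁, z, u, rfl⟩
  obtain ⟨ha₁m, ha₁d, ha₁2⟩ := hgenM a₁ ha₁
  obtain ⟨hb₁m, -, hb₁2⟩ := hgenM b₁ hb₁
  -- reduction to `Cov_μ(a₁ ∘ τ_y, (b₁ ∘ φ_{u-s}) ∘ τ_{z+x})`
  have hred : (fun x : ℤ => cov[(a₁ ∘ chainShift y) ∘ D.flow s,
      ((b₁ ∘ chainShift z) ∘ D.flow u) ∘ chainShift x; μ]) =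
      fun x : ℤ => cov[a₁ ∘ chainShift y, (b₁ ∘ D.flow (u - s)) ∘ chainShift (z + x); μ] :=
    funext fun x => D.cov_generator_pair_eq hcar hid hU0 hV0 hD ha₁m hb₁m y z x s u
  rw [hred]
  -- the local observable `f = a₁ ∘ τ_y`
  set R : ℕ := y.natAbs + 1 with hR
  have hf : DependsOn (a₁ ∘ chainShift y) (Icc (-(R : ℤ)) R) := by
    refine (dependsOn_comp_chainShift_Icc ha₁d y).mono fun i hi => ?_
    simp only [mem_Icc] at hi ⊢
    constructor <;> omega
  have hfm : Measurable (a₁ ∘ chainShift y) := ha₁m.comp (chainShift.measurable y)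
  have hf2 : MemLp (a₁ ∘ chainShift y) 2 μ := ha₁2.comp_measurePreserving (hτ y)
  -- the quasi-local observable `g = b₁ ∘ φ_{u-s}` and its approximants
  have hg2 : MemLp (b₁ ∘ D.flow (u - s)) 2 μ := hb₁2.comp_measurePreserving (hD.2 (u - s))
  obtain ⟨ε, hε0, hε, happrox⟩ := hloc b₁ hb₁ |u - s| (abs_nonneg _)
  have h := happrox (u - s) le_rfl
  choose gloc hdep hglm hgl2 happ using h
  have hint : Integrable (fun w : ℤ => cov[a₁ ∘ chainShift y, (b₁ ∘ D.flow (u - s)) ∘ chainShift w; μ])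
      (Measure.count : Measure ℤ) :=
    integrable_count_covariance_comp_chainShift hτ hC hm hmix (R := R) (R' := 1) hε0 hε hf hfm hf2
      hg2 hdep hglm hgl2 happ
  -- translate the summation index by `z`
  rw [integrable_count_iff] at hint ⊢
  exact (Equiv.summable_iff (Equiv.addLeft z)).2 hint

/-- **Zero-wavenumber data of the chain generated by an arbitrary set of generators.** Let `U, V ≥ 0`,
`D` have carrier `𝒳₀` and be the identity off `𝒳₀`, `μ` a shift-invariant probability measure preserved
by `D`, and `S ∋ j₀, h₀` a set of square-integrable generators such that every pair of translates and
time-evolutes `(a ∘ τ_x) ∘ φ_s` (`a ∈ S`) has summable truncated correlations. Then there is a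
`ZeroWavenumberData P D` with state `μ` and local observables
`𝒱 = span_ℝ {(a ∘ τ_x) ∘ φ_s : a ∈ S, x ∈ ℤ, s ∈ ℝ}`. [folklore]
-- adapted from `InfiniteChainDynamics.exists_zeroWavenumberData_of_clustering` (generators `{j₀, h₀}`) -/
theorem exists_zeroWavenumberData_of_subset (hU0 : ∀ r, 0 ≤ P.U r) (hV0 : ∀ r, 0 ≤ P.V r)
    (hcar : D.carrier = P.bmGood)
    (hid : ∀ (t : ℝ) (σ : ChainConfig), σ ∉ P.bmGood → D.flow t σ = σ)
    {μ : Measure ChainConfig} [IsProbabilityMeasure μ] (hS : IsShiftInvariant μ)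
    (hD : D.PreservesMeasure μ) (S : Set (ChainConfig → ℝ))
    (hjS : (fun σ => P.bondCurrentZ σ 0) ∈ S) (hhS : (fun σ => P.energyDensityZ σ 0) ∈ S)
    (hS2 : ∀ a ∈ S, MemLp a 2 μ)
    (hclust : ∀ a ∈ {b : ChainConfig → ℝ | ∃ a ∈ S, ∃ (x : ℤ) (s : ℝ), b = (a ∘ chainShift x) ∘ D.flow s},
      ∀ b ∈ {b : ChainConfig → ℝ | ∃ a ∈ S, ∃ (x : ℤ) (s : ℝ), b = (a ∘ chainShift x) ∘ D.flow s},
      Integrable (fun x : ℤ => cov[a, b ∘ chainShift x; μ]) (Measure.count : Measure ℤ)) :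
    ∃ Z : ZeroWavenumberData P D, Z.μ = μ ∧
      Z.localObs = Submodule.span ℝ {b : ChainConfig → ℝ |
        ∃ a ∈ S, ∃ (x : ℤ) (s : ℝ), b = (a ∘ chainShift x) ∘ D.flow s} := by
  -- the generators and their span
  set S₀ : Set (ChainConfig → ℝ) :=
    {b | ∃ a ∈ S, ∃ (x : ℤ) (s : ℝ), b = (a ∘ chainShift x) ∘ D.flow s} with hS₀
  set V₀ : Submodule ℝ (ChainConfig → ℝ) := Submodule.span ℝ S₀ with hV₀
  have hτ : ∀ x : ℤ, MeasurePreserving (chainShift x) μ μ := hS.measurePreserving_chainShift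
  -- everywhere symmetries
  have hcomm : ∀ (t : ℝ) (x : ℤ), D.flow t ∘ chainShift x = chainShift x ∘ D.flow t := fun t x =>
    funext fun σ => D.flow_chainShift_of_eq_id hcar hid hU0 hV0 t x σ
  have hadd : ∀ s t : ℝ, D.flow s ∘ D.flow t = D.flow (s + t) := fun s t =>
    funext fun σ => (D.flow_add_of_eq_id hcar hid s t σ).symm
  have hzero : D.flow 0 = id := funext fun σ => D.flow_zero_of_eq_id hcar hid σ
  -- stability of `S₀` under translations and the flow
  have hS₀shift : ∀ y : ℤ, ∀ b ∈ S₀, b ∘ chainShift y ∈ S₀ := by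
    rintro y b ⟨a, ha, x, s, rfl⟩
    refine ⟨a, ha, x + y, s, ?_⟩
    funext σ
    simp only [comp_apply]
    rw [D.flow_chainShift_of_eq_id hcar hid hU0 hV0 s y σ, ← ShiftAction.apply_add]
  have hS₀flow : ∀ t : ℝ, ∀ b ∈ S₀, b ∘ D.flow t ∈ S₀ := by
    rintro t b ⟨a, ha, x, s, rfl⟩
    refine ⟨a, ha, x, s + t, ?_⟩
    rw [← hadd s t]
    rfl
  -- linear stability of the span under a precomposition
  have hspan_comp : ∀ g : ChainConfig → ChainConfig, (∀ b ∈ S₀, b ∘ g ∈ (V₀ : Set (ChainConfig → ℝ))) →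
      ∀ b ∈ V₀, b ∘ g ∈ V₀ := by
    intro g hg b hb
    have h1 := Submodule.apply_mem_span_image_of_mem_span (LinearMap.funLeft ℝ ℝ g) hb
    have h2 : Submodule.span ℝ (LinearMap.funLeft ℝ ℝ g '' S₀) ≤ V₀ :=
      Submodule.span_le.2 (by rintro _ ⟨b, hb, rfl⟩; exact hg b hb)
    exact h2 h1
  have hV₀shift : ∀ (y : ℤ) ⦃b : ChainConfig → ℝ⦄, b ∈ V₀ → b ∘ chainShift y ∈ V₀ := fun y b hb =>
    hspan_comp _ (fun b hb => Submodule.subset_span (hS₀shift y b hb)) b hb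
  have hV₀flow : ∀ (t : ℝ) ⦃b : ChainConfig → ℝ⦄, b ∈ V₀ → b ∘ D.flow t ∈ V₀ := fun t b hb =>
    hspan_comp _ (fun b hb => Submodule.subset_span (hS₀flow t b hb)) b hb
  -- square integrability
  have hmemS₀ : ∀ b ∈ S₀, MemLp b 2 μ := by
    rintro b ⟨a, ha, x, s, rfl⟩
    exact ((hS2 a ha).comp_measurePreserving (hτ x)).comp_measurePreserving (hD.2 s)
  have hmemV₀ : ∀ ⦃b : ChainConfig → ℝ⦄, b ∈ V₀ → MemLp b 2 μ := by
    intro b hb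
    induction hb using Submodule.span_induction with
    | mem b hb => exact hmemS₀ b hb
    | zero => exact MemLp.zero
    | add b b' _ _ hb hb' => exact hb.add hb'
    | smul c b _ hb => exact hb.const_smul c
  -- the generators themselves
  have hgen : ∀ a ∈ S, a ∈ V₀ := by
    intro a ha
    refine Submodule.subset_span ⟨a, ha, 0, 0, ?_⟩
    rw [hzero]
    funext σ
    simp only [comp_apply, id_eq, ShiftAction.apply_zero]
  -- clustering of all pairs of the span, by bilinearity of the covariance on `L²`
  have hclustV : ∀ a ∈ V₀, ∀ b ∈ V₀,
      Integrable (fun x : ℤ => cov[a, b ∘ chainShift x; μ]) (Measure.count : Measure ℤ) :=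
    integrable_count_cov_of_span chainShift hτ (fun a ha => hmemV₀ ha) hclust
  -- the structure
  let F : FluctuationStructure (Measure.count : Measure ℤ) chainShift :=
    { μ := μ
      isProbabilityMeasure := inferInstance
      measurePreserving_shift := hτ
      localObs := V₀
      memLp_of_mem := hmemV₀
      comp_shift_mem := hV₀shift
      integrable_cov := fun a ha b hb => hclustV a ha b hb
      form_self_nonneg := fun a ha =>
        integral_count_covariance_comp_shift_nonneg chainShift hτ (hmemV₀ ha) (hclustV a ha a ha) }
  let Z : ZeroWavenumberData P D :=
    { toFluctuationStructure := F
      ae_mem_carrier := by rw [hcar]; simpa only [hcar] using hD.1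
      measurePreserving_flow := hD.2
      flow_comm_shift := fun t x => Eventually.of_forall fun σ => congrFun (hcomm t x) σ
      comp_flow_mem := hV₀flow
      bondCurrent_mem := hgen _ hjS
      energyDensity_mem := hgen _ hhS }
  exact ⟨Z, rfl, rfl⟩

end Generators

/-! ### §2 Cesàro means and the hydrodynamic projection (von Neumann / Suzuki) -/

section Cesaro

variable {G Ω : Type*} [AddCommGroup G] [MeasurableSpace G] [MeasurableSpace Ω]
  {ν : Measure G} {T : ShiftAction G Ω} (Dfl : FluctuationDynamics ν T)
  [MeasurableNeg G] [ν.IsNegInvariant]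

/-- **Suzuki's equality in `ℋ`**: for a strongly continuous Koopman group, the Cesàro means of the
autocorrelation `τ⁻¹∫₀^τ ⟪ψ, U_t ψ⟫` converge to the Drude weight `‖ℙψ‖²`, `ℙ = P_{𝒬₀}`
(`Mazur.tendsto_inv_mul_integral_inner` for `U_t = koopmanCLM t`, whose conserved vectors are `𝒬₀`). [folklore] -/
theorem tendsto_cesaro_inner_koopman (hcont : Dfl.IsStronglyContinuous) (ψ : Dfl.FluctuationSpace) :
    Tendsto (fun τ : ℝ => τ⁻¹ * ∫ t in (0 : ℝ)..τ, ⟪ψ, Dfl.koopman t ψ⟫_ℝ) atTop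
      (𝓝 (‖Dfl.hydroProjection ψ‖ ^ 2)) := by
  have h := Literature.Barriers.AtomisticToContinuum.Mazur.tendsto_inv_mul_integral_inner
    (GreenKuboContinuation.SpectralTrichotomy.isContractionSemigroup_koopmanCLM Dfl hcont) ψ
  simp only [GreenKuboContinuation.SpectralTrichotomy.invariantSubspace_koopmanCLM] at h
  have e : (fun τ : ℝ => τ⁻¹ * ∫ t in (0 : ℝ)..τ, ⟪ψ, Dfl.koopman t ψ⟫_ℝ) =
      fun τ : ℝ => τ⁻¹ * ∫ t in (0 : ℝ)..τ, ⟪Dfl.koopmanCLM t ψ, ψ⟫_ℝ := by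
    funext τ
    congr 1
    refine intervalIntegral.integral_congr fun t _ => ?_
    simp only [Dfl.koopman_apply]
    exact real_inner_comm _ _
  rw [e]
  exact h

/-- **No Drude weight from small Cesàro means.** If for every `η > 0` the Cesàro means
`τ⁻¹∫₀^τ ⟪φ, U_t φ⟫` are eventually bounded by `η` in absolute value, then `ℙφ = 0`. [folklore] -/
theorem hydroProjection_eq_zero_of_cesaro_le (hcont : Dfl.IsStronglyContinuous) (φ : Dfl.FluctuationSpace)
    (h : ∀ η : ℝ, 0 < η → ∃ τ₀ : ℝ, ∀ τ : ℝ, τ₀ ≤ τ →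
      |τ⁻¹ * ∫ t in (0 : ℝ)..τ, ⟪φ, Dfl.koopman t φ⟫_ℝ| ≤ η) :
    Dfl.hydroProjection φ = 0 := by
  have hlim := (tendsto_cesaro_inner_koopman Dfl hcont φ).abs
  have hle : ∀ η : ℝ, 0 < η → |‖Dfl.hydroProjection φ‖ ^ 2| ≤ η := by
    intro η hη
    obtain ⟨τ₀, hτ₀⟩ := h η hη
    exact le_of_tendsto hlim (eventually_atTop.2 ⟨τ₀, hτ₀⟩)
  have h0 : ‖Dfl.hydroProjection φ‖ ^ 2 ≤ 0 := by
    refine le_of_forall_pos_le_add fun η hη => ?_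
    rw [zero_add]
    exact (le_abs_self _).trans (hle η hη)
  have h1 : ‖Dfl.hydroProjection φ‖ = 0 := by
    have := sq_nonneg ‖Dfl.hydroProjection φ‖
    nlinarith [norm_nonneg (Dfl.hydroProjection φ)]
  exact norm_eq_zero.1 h1

/-- `‖ℙψ‖ ≤ ‖ψ - φ‖` whenever `ℙφ = 0` (`ℙ` is a linear contraction). [folklore] -/
theorem norm_hydroProjection_le_norm_sub (ψ φ : Dfl.FluctuationSpace) (hφ : Dfl.hydroProjection φ = 0) :
    ‖Dfl.hydroProjection ψ‖ ≤ ‖ψ - φ‖ := by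
  have e : Dfl.hydroProjection ψ = Dfl.hydroProjection (ψ - φ) := by
    rw [map_sub, hφ, sub_zero]
  rw [e]
  exact Submodule.norm_starProjection_apply_le _ _

/-- The Cesàro limit of `⟪ψ, U_t ψ⟫` is at most `‖ψ - φ‖²` for every `φ` with `ℙφ = 0`. [folklore] -/
theorem tendsto_cesaro_inner_koopman_le (hcont : Dfl.IsStronglyContinuous) (ψ φ : Dfl.FluctuationSpace)
    (hφ : Dfl.hydroProjection φ = 0) :
    ∃ d : ℝ, 0 ≤ d ∧ d ≤ ‖ψ - φ‖ ^ 2 ∧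
      Tendsto (fun τ : ℝ => τ⁻¹ * ∫ t in (0 : ℝ)..τ, ⟪ψ, Dfl.koopman t ψ⟫_ℝ) atTop (𝓝 d) := by
  refine ⟨‖Dfl.hydroProjection ψ‖ ^ 2, sq_nonneg _, ?_, tendsto_cesaro_inner_koopman Dfl hcont ψ⟩
  have h := norm_hydroProjection_le_norm_sub Dfl ψ φ hφ
  exact pow_le_pow_left₀ (norm_nonneg _) h 2

end Cesaro

/-! ### §3 The zero-wavenumber norm of a strictly local observable under `ρ`-mixing -/

section LocalNorm

variable {μ : Measure ChainConfig} [IsProbabilityMeasure μ]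

/-- **`Σ_w |Cov_μ(f, f ∘ τ_w)| ≤ K ∫ f²` for `f` reading the sites of `[-1, 1]`.** Under exponential
`ρ`-mixing (constants `C ≥ 0`, `m > 0`) of a shift-invariant probability measure there is ONE constant
`K = K(C, m) ≥ 0` such that for every measurable square-integrable `f` depending on the sites of `[-1, 1]`
the truncated autocorrelations are absolutely summable with `Σ_w |Cov_μ(f, f ∘ τ_w)| ≤ K ∫ f² dμ`
(Cauchy–Schwarz for `|w| ≤ 1`, the mixing bound with gap `|w| - 2` beyond). [folklore] -/
theorem exists_tsum_abs_cov_self_le_of_mixing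
    (hS : ∀ x : ℤ, MeasurePreserving (chainShift x) μ μ) {C m : ℝ} (hC : 0 ≤ C) (hm : 0 < m)
    (hmix : ∀ (a : ℤ) (n : ℕ) (f g : ChainConfig → ℝ),
      DependsOn f {i : ℤ | i ≤ a} → DependsOn g {i : ℤ | a + n ≤ i} → Measurable f → Measurable g →
      MemLp f 2 μ → MemLp g 2 μ →
      |∫ σ, f σ * g σ ∂μ - (∫ σ, f σ ∂μ) * ∫ σ, g σ ∂μ| ≤
        C * Real.exp (-(m * n)) * (∫ σ, f σ ^ 2 ∂μ) ^ (1 / 2 : ℝ) * (∫ σ, g σ ^ 2 ∂μ) ^ (1 / 2 : ℝ)) :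
    ∃ K : ℝ, 0 ≤ K ∧ ∀ f : ChainConfig → ℝ, DependsOn f (Icc (-1 : ℤ) 1) → Measurable f → MemLp f 2 μ →
      Summable (fun w : ℤ => |cov[f, f ∘ chainShift w; μ]|) ∧
        ∑' w : ℤ, |cov[f, f ∘ chainShift w; μ]| ≤ K * ∫ σ, f σ ^ 2 ∂μ := by
  -- the majorant profile `Φ(|w|)`
  set Φ : ℕ → ℝ := fun k => if k < 2 then 1 else C * Real.exp (-(m * ((k - 2 : ℕ) : ℝ))) with hΦ
  have hΦ0 : ∀ k, 0 ≤ Φ k := by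
    intro k
    by_cases hk : k < 2
    · simp only [hΦ, hk, if_true]; exact zero_le_one
    · simp only [hΦ, hk, if_false]; positivity
  have hΦs : Summable Φ := by
    refine (summable_nat_add_iff 2).1 ?_
    have e : (fun k : ℕ => Φ (k + 2)) = fun k : ℕ => C * Real.exp (-m) ^ k := by
      funext k
      have hk : ¬ (k + 2 < 2) := by omega
      simp only [hΦ, hk, if_false, Nat.add_sub_cancel]
      rw [← Real.exp_nat_mul]; ring_nf
    rw [e]
    exact (summable_geometric_of_lt_one (Real.exp_nonneg _) (Real.exp_lt_one_iff.2 (by linarith))).mul_left C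
  have hKs : Summable fun w : ℤ => Φ w.natAbs := summable_int_comp_natAbs hΦs
  refine ⟨∑' w : ℤ, Φ w.natAbs, tsum_nonneg fun w => hΦ0 _, fun f hf hfm hf2 => ?_⟩
  -- the termwise bound `|Cov(f, f ∘ τ_w)| ≤ Φ(|w|) ∫ f²`
  have hI0 : 0 ≤ ∫ σ, f σ ^ 2 ∂μ := integral_nonneg fun _ => sq_nonneg _
  have hterm : ∀ w : ℤ, |cov[f, f ∘ chainShift w; μ]| ≤ Φ w.natAbs * ∫ σ, f σ ^ 2 ∂μ := by
    intro w
    by_cases hw : w.natAbs < 2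
    · -- Cauchy–Schwarz
      simp only [hΦ, hw, if_true, one_mul]
      have hfw2 : MemLp (f ∘ chainShift w) 2 μ := hf2.comp_measurePreserving (hS w)
      refine (abs_covariance_le_sqrt_mul_sqrt hf2 hfw2).trans ?_
      rw [integral_sq_comp_eq (hS w) hf2.aestronglyMeasurable, Real.mul_self_sqrt hI0]
    · -- mixing with gap `|w| - 2`
      simp only [hΦ, hw, if_false]
      have hle : 2 ≤ w.natAbs := not_lt.1 hw
      have hwz : ((0 : ℕ) : ℤ) + (1 : ℕ) + (1 : ℕ) ≤ |w| := by
        have h2 : (2 : ℤ) ≤ (w.natAbs : ℤ) := by exact_mod_cast hle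
        rw [Int.natCast_natAbs] at h2
        push_cast
        linarith
      have hf' : DependsOn f (Icc (-((1 : ℕ) : ℤ)) (1 : ℕ)) := by simpa using hf
      have hh' : DependsOn f (Icc (-((0 : ℕ) : ℤ) - (1 : ℕ)) ((0 : ℕ) + (1 : ℕ))) := by simpa using hf
      have key := abs_covariance_comp_chainShift_le_of_mixing_of_le hS hmix hf' hfm hf2 hh' hfm hf2 hwz
      have e1 : (w.natAbs - 0 - 1 - 1 : ℕ) = w.natAbs - 2 := by omega
      rw [e1, mul_assoc, Real.mul_self_sqrt hI0] at key
      exact key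
  have hsum : Summable (fun w : ℤ => |cov[f, f ∘ chainShift w; μ]|) :=
    Summable.of_nonneg_of_le (fun w => abs_nonneg _) hterm (hKs.mul_right _)
  refine ⟨hsum, ?_⟩
  calc ∑' w : ℤ, |cov[f, f ∘ chainShift w; μ]| ≤ ∑' w : ℤ, Φ w.natAbs * ∫ σ, f σ ^ 2 ∂μ :=
        hsum.tsum_le_tsum hterm (hKs.mul_right _)
    _ = (∑' w : ℤ, Φ w.natAbs) * ∫ σ, f σ ^ 2 ∂μ := tsum_mul_right

end LocalNorm

end Summit.AtomisticToContinuum.FouriersLaw.Theorems.NonBallistic.DrudeFromTruncation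

namespace Summit.AtomisticToContinuum.FouriersLaw.Theorems.NonBallistic

open MeasureTheory ProbabilityTheory Filter Topology
open scoped NNReal ENNReal BigOperators
open Literature.MathematicalPhysics.KineticTheory
open Literature.MathematicalPhysics.KineticTheory.HeatConduction
open Summit.AtomisticToContinuum.FouriersLaw.Theorems.NonBallistic.DrudeFromTruncation

/-- **Registered sub-goal `stub_zeroWavenumberDataOfGenerators`** (stub `stub_drudeFromTruncationRegular`, DFT′, line
`drude-controls-conductance`, R3b): Doyon's zero-wavenumber data of the chain generated by an ARBITRARY set of
square-integrable generators containing `j₀, h₀` with summably clustering translates and time-evolutes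
(`exists_zeroWavenumberData_of_subset`, closed form). [folklore] -/
theorem stub_zeroWavenumberDataOfGenerators :
    ∀ (P : OscillatorChain) (D : InfiniteChainDynamics P), (∀ r : ℝ, 0 ≤ P.U r) → (∀ r : ℝ, 0 ≤ P.V r) → D.carrier = P.bmGood → (∀ (t : ℝ) (σ : ChainConfig), σ ∉ P.bmGood → D.flow t σ = σ) → ∀ (μ : Measure ChainConfig), IsProbabilityMeasure μ → IsShiftInvariant μ → D.PreservesMeasure μ → ∀ S : Set (ChainConfig → ℝ), (fun σ : ChainConfig => P.bondCurrentZ σ 0) ∈ S → (fun σ : ChainConfig => P.energyDensityZ σ 0) ∈ S → (∀ a ∈ S, MemLp a 2 μ) → (∀ a ∈ {b : ChainConfig → ℝ | ∃ a ∈ S, ∃ (x : ℤ) (s : ℝ), b = (a ∘ chainShift x) ∘ D.flow s}, ∀ b ∈ {b : ChainConfig → ℝ | ∃ a ∈ S, ∃ (x : ℤ) (s : ℝ), b = (a ∘ chainShift x) ∘ D.flow s}, Integrable (fun x : ℤ => cov[a, b ∘ chainShift x; μ]) (Measure.count : Measure ℤ)) → ∃ Z : ZeroWavenumberData P D, Z.μ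 = μ ∧ Z.localObs = Submodule.span ℝ {b : ChainConfig → ℝ | ∃ a ∈ S, ∃ (x : ℤ) (s : ℝ), b = (a ∘ chainShift x) ∘ D.flow s} :=
  fun _ D hU0 hV0 hcar hid _ hP hS hD S hjS hhS hS2 hclust =>
    haveI := hP
    exists_zeroWavenumberData_of_subset D hU0 hV0 hcar hid hS hD S hjS hhS hS2 hclust

end Summit.AtomisticToContinuum.FouriersLaw.Theorems.NonBallistic

end
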